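import Summits.CriticalPhenomena.PercolationContinuityZ3.Theorems.PercNearOneGluingNoHeavyQuantGatedSliceMixLawRegimeBG
import Summits.CriticalPhenomena.PercolationContinuityZ3.Theorems.PercNearOneGluingNoHeavyQuantGatedSliceMixLawCells
import HarnessLib

/-!
# QUANT lane R8, T-DEC, leg (III), blob case — `LawDec.MixLawRegimeB` (the regime-B node of `GatedSliceMixLaw'`'s cell assembly) FROM ITS TWO
# RESIDUAL CELLS: cell B-G is the kernel theorem `gatedSliceMixLaw_regimeBG`; what remains is cell B-M (`k₂ ≤ j`, a mid of the moved law) and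
# cell B-L (the shifted atom `k₁ + a` NOT a `t`-low) — stated here as explicit hypotheses, so that their provers (census-2 g61) target exact binders

builds on p205010 (kernel theorem, internal audit signed; external expert review pending)

Support file (`--supports stmt-CriticalPhenomena-4575`), QUANT lane lead seat (gen 32), rung R8 of `run/shared/lean/prim/quant/LADDER.md`.
Memo `run/shared/lean/prim/quant/prim-quant-lead-g32/FOR-PROVERS-MIXLAW-KINKS.md` §7.  One theorem, standard axioms, no sorries, no definitions.

`LawDec.MixLawRegimeB` (typer g30, `…QuantGatedSliceMixLawCells`) is the antecedent of `gatedSliceMixLaw'_of_residualCells` covering the whole of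
regime B (`h + a ≥ j+1`: the weak-mid law has one mid `h` and the giant `h + a`; `k₁` a `t`-low, `k₁ + a ≤ j`, `k₂ + a ≥ j+1`, `t ≤ 2S`).  Case tree:
* `2(k₁+a) < t` and `k₂ ≥ j+1` — CELL B-G: `gatedSliceMixLaw_regimeBG` (`…RegimeBG`, lead g32: first kink with (⋆) proved for `k₁ < ag(1−z)`, second
  kink for `k₁ ≥ ag(1−z)`);
* `2(k₁+a) < t` and `k₂ ≤ j` — CELL B-M (hypothesis `hBM` below; census-2 g61: pooled kink, `…Pooled` p350294 for `k₂ = h`);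
* `t ≤ 2(k₁+a)` — CELL B-L, the shifted atom is an absorber (hypothesis `hBL`; census-2 g61 / typer's C3–C4 twins in regime B).
So **`mixLawRegimeB_of_cells : (cell B-M) → (cell B-L) → MixLawRegimeB`**; both hypotheses are `MixLawRegimeB`'s binder verbatim plus the cell condition(s).

[this work].  The gluing rows served [cite: KozmaNitzan2024, Conjecture 3 (p. 15)]; product measure [cite: Grimmett1999, §1.3 p. 10].
-/

noncomputable section

namespace Summit.CriticalPhenomena.PercolationContinuityZ3.Theorems

namespace Quant

open Finset

/-- the two-point law `{lo, hi; g}` (as in `…QuantLawDEC`) -/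
local notation3 "TP[" lo ", " hi ", " g ", " h "]" =>
  (g : ℝ) * (if (h : ℕ) = (hi : ℕ) then (1 : ℝ) else 0) + (1 - (g : ℝ)) * (if (h : ℕ) = (lo : ℕ) then (1 : ℝ) else 0)

namespace LawDec

/-- **`MixLawRegimeB` from cells B-M and B-L** (cell B-G being the theorem `gatedSliceMixLaw_regimeBG`).  `hBM`: the binder of `MixLawRegimeB`
plus `2(k₁+a) < t` and `k₂ ≤ j`; `hBL`: the binder of `MixLawRegimeB` plus `t ≤ 2(k₁+a)`. [this work] -/
theorem mixLawRegimeB_of_cells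
    (hBM : ∀ (y z g S lam : ℝ) (a j M h k₁ k₂ : ℕ),
      0 < y → y < 1 → 0 ≤ z → z < 1 → g ≤ 1 → y ≤ (1 - z) * g → 1 ≤ a → j < M + a → 0 < S → y * (M : ℝ) ≤ S →
      h ≤ j → h ≤ M → S < (h : ℝ) →
      ¬ DECAtT y (S + (a : ℝ) * g * (1 - z)) j (M + a) (weakMidLaw S g h a) →
      k₁ ≤ k₂ → k₂ ≤ M → 0 ≤ lam → lam ≤ 1 → (1 - z) * ((k₁ : ℝ) + ((k₂ : ℝ) - k₁) * lam) = S →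
      k₁ ≤ j → 2 * (k₁ : ℝ) < S + (a : ℝ) * g * (1 - z) → k₁ + a ≤ j → j + 1 ≤ k₂ + a →
      S + (a : ℝ) * g * (1 - z) ≤ 2 * S → j + 1 ≤ h + a →
      2 * ((k₁ + a : ℕ) : ℝ) < S + (a : ℝ) * g * (1 - z) → k₂ ≤ j →
      ∃ θ : ℝ, 0 ≤ θ ∧ θ < 1 ∧
        DECAtT y (S + (a : ℝ) * g * (1 - z)) j (M + a)
          (fun p => θ * weakMidLaw S g h a p
            + (1 - θ) * (z * (if p = 0 then (1 : ℝ) else 0) + (1 - z) * slice (fun q => TP[k₁, k₂, lam, q]) a g p)))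
    (hBL : ∀ (y z g S lam : ℝ) (a j M h k₁ k₂ : ℕ),
      0 < y → y < 1 → 0 ≤ z → z < 1 → g ≤ 1 → y ≤ (1 - z) * g → 1 ≤ a → j < M + a → 0 < S → y * (M : ℝ) ≤ S →
      h ≤ j → h ≤ M → S < (h : ℝ) →
      ¬ DECAtT y (S + (a : ℝ) * g * (1 - z)) j (M + a) (weakMidLaw S g h a) →
      k₁ ≤ k₂ → k₂ ≤ M → 0 ≤ lam → lam ≤ 1 → (1 - z) * ((k₁ : ℝ) + ((k₂ : ℝ) - k₁) * lam) = S →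
      k₁ ≤ j → 2 * (k₁ : ℝ) < S + (a : ℝ) * g * (1 - z) → k₁ + a ≤ j → j + 1 ≤ k₂ + a →
      S + (a : ℝ) * g * (1 - z) ≤ 2 * S → j + 1 ≤ h + a →
      S + (a : ℝ) * g * (1 - z) ≤ 2 * ((k₁ + a : ℕ) : ℝ) →
      ∃ θ : ℝ, 0 ≤ θ ∧ θ < 1 ∧
        DECAtT y (S + (a : ℝ) * g * (1 - z)) j (M + a)
          (fun p => θ * weakMidLaw S g h a p
            + (1 - θ) * (z * (if p = 0 then (1 : ℝ) else 0) + (1 - z) * slice (fun q => TP[k₁, k₂, lam, q]) a g p))) :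
    MixLawRegimeB := by
  intro y z g S lam a j M h k₁ k₂ hy0 hy1 hz0 hz1 hg1 hyg ha1 hjM hS0 hta hhj hhM hSh hW hk hk₂M hlam0 hlam1 hmean
    hk₁j hk1low hdj hk₂aG ht2S hhaG
  by_cases hdlow : 2 * ((k₁ + a : ℕ) : ℝ) < S + (a : ℝ) * g * (1 - z)
  · by_cases hk₂G : j + 1 ≤ k₂
    · -- cell B-G
      have hhmid : S + (a : ℝ) * g * (1 - z) ≤ 2 * (h : ℝ) := by linarith
      exact gatedSliceMixLaw_regimeBG y z g S lam a j M h k₁ k₂ hy0 hy1 hz0 hz1 hg1 hyg ha1 hS0 hta hhj hhM hSh hW hk hk₂M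
        hlam0 hlam1 hmean hdlow hdj hk₂G hhaG hhmid
    · -- cell B-M
      exact hBM y z g S lam a j M h k₁ k₂ hy0 hy1 hz0 hz1 hg1 hyg ha1 hjM hS0 hta hhj hhM hSh hW hk hk₂M hlam0 hlam1 hmean
        hk₁j hk1low hdj hk₂aG ht2S hhaG hdlow (by omega)
  · -- cell B-L
    exact hBL y z g S lam a j M h k₁ k₂ hy0 hy1 hz0 hz1 hg1 hyg ha1 hjM hS0 hta hhj hhM hSh hW hk hk₂M hlam0 hlam1 hmean
      hk₁j hk1low hdj hk₂aG ht2S hhaG (not_lt.1 hdlow)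

end LawDec

end Quant

end Summit.CriticalPhenomena.PercolationContinuityZ3.Theorems
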